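import Mathlib
import Literature.Barriers.MatrixMultiplication.NormalizerBarrier
import Literature.RepresentationTheory.FiniteGroups.IrreducibleCharacters
import Summits.MatrixMultiplication.MatrixMultiplication.Theorems.LieRankDesigns.Negative.Basics
import Summits.MatrixMultiplication.MatrixMultiplication.Theorems.SubgroupIdentityDesigns.Negative.BlockSliceTranslate
import Summits.MatrixMultiplication.MatrixMultiplication.Theorems.SubgroupIdentityDesigns.Negative.FlagNoGo
import Summits.MatrixMultiplication.MatrixMultiplication.Theorems.SubgroupIdentityDesigns.Negative.FlagWindow
import Summits.MatrixMultiplication.MatrixMultiplication.Theorems.SubgroupIdentityDesigns.Negative.FlagTwistNoGo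

/-!
# Block-slice no-go: summary statement (BLOCK-SLICES Thm 2.4, kernel-checked regimes)

Supports stmt-MatrixMultiplication-14079 (crux `SubgroupIdentityDesigns`, route
`LevelGradedCohnUmans`).  VALUE = theorem, NOT summit progress.  One citation point for the
four landed no-go theorems on subgroup-TPP triples of `GL_{k+l}(𝔽_p)` whose product set lies
in a translate `x S_{k+l,k} y` of the block slice `S_{k+l,k} = {g : lower-right l×l block = 1}`
(`k ≥ 1`, `l ≥ 3`):
* `k = 1`, all `p`                       — `BlockSliceTranslate.no_translate_witness_one`;
* `p ≥ k + 2`                            — `FlagTwistNoGo.no_translate_witness`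
  (irreducible twisted flag character);
* `(k+1)⁶ ≤ p^{l-3}`                     — `FlagWindow.no_translate_witness_of_pow_le`;
* `l ≥ 3 + 6⌈log₂(k+1)⌉`, all `p`        — `FlagNoGo.no_translate_witness`.
`no_translate_witness` below is their disjunction; `corner` records that the hypotheses can
only fail in the finite corner `k ≥ 2`, `p ≤ k + 1`, `3 ≤ l < 3 + 6⌈log₂(k+1)⌉` (per `k`, finitely
many `(p, l)`), where the no-go is known only conditionally (`BlockSliceConditional`, needing a
level-`k` character of norm `≤ 2` and degree `≥ p^{kl+k(k-1)/2}`, e.g. `Ind_{P_k}(St_k ⊠ 1)`).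
-/

set_option linter.dupNamespace false

noncomputable section

open scoped BigOperators Matrix
open Literature.Barriers.MatrixMultiplication (SubgroupTPP)
open Literature.RepresentationTheory.FiniteGroups
open Summit.MatrixMultiplication.MatrixMultiplication.Theorems.LieRankDesigns.Negative

namespace Summit.MatrixMultiplication.MatrixMultiplication.Theorems.SubgroupIdentityDesigns.Negative
namespace BlockSliceSummary

variable {p : ℕ} [hp : Fact p.Prime] {k l : ℕ}

/-- **Block-slice no-go (all kernel-checked regimes).**  Let `k ≥ 1`, `l ≥ 3` and assume one of:
`k = 1`; `p ≥ k + 2`; `(k+1)⁶ ≤ p^{l-3}`; `l ≥ 3 + 6⌈log₂(k+1)⌉`.  Then for every `ε > 0`, no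
subgroup-TPP triple `H₁, H₂, H₃ ≤ GL_{k+l}(𝔽_p)` whose products `a b c` all lie in a translate
`x S_{k+l,k} y` of the block slice satisfies the budget inequality of `SubgroupIdentityDesigns`
(`∑_{ψ irreducible, level ≤ k} ψ(1)^{2+ε} < (|H₁||H₂||H₃|)^{(2+ε)/3}`). -/
theorem no_translate_witness (hk : 1 ≤ k) (hl : 3 ≤ l)
    (hreg : k = 1 ∨ k + 2 ≤ p ∨ (k + 1) ^ 6 ≤ p ^ (l - 3) ∨ 3 + 6 * Nat.clog 2 (k + 1) ≤ l)
    {H₁ H₂ H₃ : Subgroup (GLm p (k + l))} (htpp : SubgroupTPP H₁ H₂ H₃) (x y : GLm p (k + l))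
    (hS : ∀ a ∈ H₁, ∀ b ∈ H₂, ∀ c ∈ H₃, ∀ i j : Fin l,
      ((x⁻¹ * (a * b * c) * y⁻¹ : GLm p (k + l)) : Mat p (k + l)) (Fin.natAdd k i)
          (Fin.natAdd k j) = (1 : Matrix (Fin l) (Fin l) (ZMod p)) i j)
    {ε : ℝ} (hε : 0 < ε) :
    ¬ ((∑ᶠ ψ ∈ irrChars (GLm p (k + l)) ∩ levelSet p (k + l) k, (ψ 1).re ^ (2 + ε)) <
        ((Nat.card H₁ * Nat.card H₂ * Nat.card H₃ : ℕ) : ℝ) ^ ((2 + ε) / 3)) := by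
  rcases hreg with rfl | hpk | hpow | hlog
  · exact BlockSliceTranslate.no_translate_witness_one hl htpp x y hS hε
  · exact FlagTwistNoGo.no_translate_witness hk hl hpk htpp x y hS hε
  · exact FlagWindow.no_translate_witness_of_pow_le hk hl hpow htpp x y hS hε
  · exact FlagNoGo.no_translate_witness hk hlog htpp x y hS hε

/-- The block slice itself (`x = y = 1`). -/
theorem no_slice_witness (hk : 1 ≤ k) (hl : 3 ≤ l)
    (hreg : k = 1 ∨ k + 2 ≤ p ∨ (k + 1) ^ 6 ≤ p ^ (l - 3) ∨ 3 + 6 * Nat.clog 2 (k + 1) ≤ l)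
    {H₁ H₂ H₃ : Subgroup (GLm p (k + l))} (htpp : SubgroupTPP H₁ H₂ H₃)
    (hS : ∀ a ∈ H₁, ∀ b ∈ H₂, ∀ c ∈ H₃, ∀ i j : Fin l,
      ((a * b * c : GLm p (k + l)) : Mat p (k + l)) (Fin.natAdd k i) (Fin.natAdd k j) =
        (1 : Matrix (Fin l) (Fin l) (ZMod p)) i j)
    {ε : ℝ} (hε : 0 < ε) :
    ¬ ((∑ᶠ ψ ∈ irrChars (GLm p (k + l)) ∩ levelSet p (k + l) k, (ψ 1).re ^ (2 + ε)) <
        ((Nat.card H₁ * Nat.card H₂ * Nat.card H₃ : ℕ) : ℝ) ^ ((2 + ε) / 3)) :=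
  no_translate_witness hk hl hreg htpp 1 1
    (fun a ha b hb c hc i j => by simpa using hS a ha b hb c hc i j) hε

/-- **All but finitely many primes**: for fixed `k ≥ 1` and `l ≥ 3` the block-slice no-go holds for
every prime `p ≥ k + 2`, every `ε > 0` and every translate. -/
theorem no_translate_witness_eventually (hk : 1 ≤ k) (hl : 3 ≤ l) :
    ∀ᶠ q : ℕ in Filter.atTop, ∀ [Fact q.Prime], ∀ {H₁ H₂ H₃ : Subgroup (GLm q (k + l))},
      SubgroupTPP H₁ H₂ H₃ → ∀ x y : GLm q (k + l),
      (∀ a ∈ H₁, ∀ b ∈ H₂, ∀ c ∈ H₃, ∀ i j : Fin l,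
        ((x⁻¹ * (a * b * c) * y⁻¹ : GLm q (k + l)) : Mat q (k + l)) (Fin.natAdd k i)
            (Fin.natAdd k j) = (1 : Matrix (Fin l) (Fin l) (ZMod q)) i j) →
      ∀ {ε : ℝ}, 0 < ε →
        ¬ ((∑ᶠ ψ ∈ irrChars (GLm q (k + l)) ∩ levelSet q (k + l) k, (ψ 1).re ^ (2 + ε)) <
            ((Nat.card H₁ * Nat.card H₂ * Nat.card H₃ : ℕ) : ℝ) ^ ((2 + ε) / 3)) := by
  refine Filter.eventually_atTop.mpr ⟨k + 2, fun q hq _ H₁ H₂ H₃ htpp x y hS ε hε => ?_⟩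
  exact no_translate_witness hk hl (Or.inr (Or.inl hq)) htpp x y hS hε

omit hp in
/-- **The residual corner.**  If none of the four regimes applies then `k ≥ 2`, `p ≤ k + 1` and
`l < 3 + 6⌈log₂(k+1)⌉` — for each `k` a finite set of pairs `(p, l)`. -/
theorem corner (hk : 1 ≤ k)
    (hreg : ¬ (k = 1 ∨ k + 2 ≤ p ∨ (k + 1) ^ 6 ≤ p ^ (l - 3) ∨ 3 + 6 * Nat.clog 2 (k + 1) ≤ l)) :
    2 ≤ k ∧ p ≤ k + 1 ∧ l < 3 + 6 * Nat.clog 2 (k + 1) := by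
  push Not at hreg
  obtain ⟨h1, h2, -, h4⟩ := hreg
  exact ⟨by omega, by omega, by omega⟩

/-- Ambient form: `m ≥ k + 3`, regimes phrased with `m = k + l`. -/
theorem no_slice_witness' {m : ℕ} (hk : 1 ≤ k) (hm : k + 3 ≤ m)
    (hreg : k = 1 ∨ k + 2 ≤ p ∨ (k + 1) ^ 6 ≤ p ^ (m - k - 3) ∨
      k + 3 + 6 * Nat.clog 2 (k + 1) ≤ m) :
    ∃ l, m = k + l ∧ ∀ {H₁ H₂ H₃ : Subgroup (GLm p (k + l))}, SubgroupTPP H₁ H₂ H₃ →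
      (∀ a ∈ H₁, ∀ b ∈ H₂, ∀ c ∈ H₃, ∀ i j : Fin l,
        ((a * b * c : GLm p (k + l)) : Mat p (k + l)) (Fin.natAdd k i) (Fin.natAdd k j) =
          (1 : Matrix (Fin l) (Fin l) (ZMod p)) i j) →
      ∀ {ε : ℝ}, 0 < ε →
        ¬ ((∑ᶠ ψ ∈ irrChars (GLm p (k + l)) ∩ levelSet p (k + l) k, (ψ 1).re ^ (2 + ε)) <
            ((Nat.card H₁ * Nat.card H₂ * Nat.card H₃ : ℕ) : ℝ) ^ ((2 + ε) / 3)) := by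
  refine ⟨m - k, by omega, fun htpp hS _ hε => no_slice_witness hk (by omega) ?_ htpp hS hε⟩
  rcases hreg with h | h | h | h
  · exact Or.inl h
  · exact Or.inr (Or.inl h)
  · exact Or.inr (Or.inr (Or.inl (by rwa [show m - k - 3 = m - k - 3 from rfl] at h)))
  · exact Or.inr (Or.inr (Or.inr (by omega)))

end BlockSliceSummary
end Summit.MatrixMultiplication.MatrixMultiplication.Theorems.SubgroupIdentityDesigns.Negative
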